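import Mathlib

/-!
# Frame cap by determinants: a complementary-frame ladder has at most `C(2l, l)` classes

Support file (siege attempt k5, "Mathlib API route") for item `stmt-MatrixMultiplication-14308`
(`Summit.MatrixMultiplication.MatrixMultiplication.Theses.FourierTwoFamiliesModP.PrimeTwoFamilies`,
CKSU 2005 Conj. 4.7 with prime cyclic hosts), registered stub `frameCap`:

> if `V c, W c ≤ F^{2l}` (`c : Fin r`) are `l`-dimensional, `V c ⊓ W c = ⊥` for every `c`, and
> `V p ⊔ W q ≠ ⊤` whenever `p < q`, then `r ≤ Nat.choose (2 * l) l`.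

This is Lovász's (1977) skew version of the Bollobás two-families theorem for subspaces, in
the complementary case `dim V + dim W = dim E`, where no generic projection is needed; the bound
is attained by the coordinate frames (CKSU Prop. 4.5).

## Proof (determinant form + alternating forms; no exterior powers)

Write `E = Fin (2 * l) → F` and let `D : E [⋀^(Fin l ⊕ Fin l)]→ₗ[F] F` be the determinant form
of the standard basis reindexed along `Fin l ⊕ Fin l ≃ Fin (2 * l)` (`Module.Basis.det`).
Choose basis families `a c, b c : Fin l → E` of `V c`, `W c`.

* `D (a c ‖ b c) ≠ 0`: the `2l` vectors span `V c ⊔ W c = ⊤` (dimension count using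
  `V c ⊓ W c = ⊥`), hence form a basis (`Module.Basis.is_basis_iff_det`).
* `D (a p ‖ b q) = 0` for `p < q`: the vectors lie in `V p ⊔ W q ≠ ⊤`; `2l` independent vectors
  would span `E`, so the family is dependent and `D` kills it (`AlternatingMap.map_linearDependent`).

Currying `D` in its second block (`MultilinearMap.currySum`) gives alternating `l`-forms
`x p : w ↦ D (a p ‖ w)` with `x p (b q) = D (a p ‖ b q)`, a lower-triangular matrix with nonzero
diagonal, hence nonzero determinant (`Matrix.det_of_lowerTriangular`); evaluating a vanishing
combination `∑ g p • x p = 0` at the `b q` gives `g ᵥ* M = 0`, so `g = 0`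
(`Matrix.eq_zero_of_vecMul_eq_zero`): the `x p` are linearly independent.

Finally (`altForm_card_le_choose`) an alternating `k`-form on `Fin n → F` is determined by its
values on INCREASING `k`-tuples of standard basis vectors (`Module.Basis.ext_alternating`, after
sorting an injective index map through `Finset.orderIsoOfFin` and paying a sign,
`AlternatingMap.map_perm`); so restriction to `Finset.powersetCard k univ → F` is an injective
linear map and an independent family of alternating `k`-forms has at most `Nat.choose n k` members.

This is a second, exterior-power-free proof of the stub, next to the lead's
`FourierTwoFamiliesModPPrimeTwoFamiliesFrameCap.lean` (namespace `…PrimeTwoFamilies.LadderLift`).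
-/

-- single-conjunct summit: the mandated namespace repeats `MatrixMultiplication` (summit = sub-problem).
set_option linter.dupNamespace false

namespace Summit.MatrixMultiplication.MatrixMultiplication.Theorems.PrimeTwoFamilies.FrameCapSiegeK5

/-- Dimension bound for alternating forms, injective-restriction form: a linearly independent
family of alternating `k`-forms on `Fin n → F` has at most `Nat.choose n k` members, because a
form is determined by its values on increasing `k`-tuples of standard basis vectors. -/
theorem altForm_card_le_choose {F : Type*} [Field F] {n k r : ℕ}
    (x : Fin r → ((Fin n → F) [⋀^Fin k]→ₗ[F] F)) (hx : LinearIndependent F x) :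
    r ≤ n.choose k := by
  classical
  have hcard : ∀ S : (Finset.univ : Finset (Fin n)).powersetCard k,
      (S : Finset (Fin n)).card = k := fun S => (Finset.mem_powersetCard.1 S.2).2
  -- restriction to increasing `k`-tuples of standard basis vectors
  let Φ : ((Fin n → F) [⋀^Fin k]→ₗ[F] F) →ₗ[F]
      ((Finset.univ : Finset (Fin n)).powersetCard k → F) :=
    { toFun := fun f S => f fun i =>
        Pi.basisFun F (Fin n) ((S : Finset (Fin n)).orderEmbOfFin (hcard S) i)
      map_add' := fun _ _ => rfl
      map_smul' := fun _ _ => rfl }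
  have hΦ : LinearMap.ker Φ = ⊥ := by
    rw [LinearMap.ker_eq_bot']
    intro f hf
    refine Module.Basis.ext_alternating (Pi.basisFun F (Fin n)) fun v hv => ?_
    rw [AlternatingMap.zero_apply]
    -- the image `S` of the injective index map `v`, and `v` sorted through `S`
    set S : Finset (Fin n) := Finset.univ.image v with hS
    have hSP : S ∈ (Finset.univ : Finset (Fin n)).powersetCard k := by
      rw [Finset.mem_powersetCard]
      refine ⟨Finset.subset_univ _, ?_⟩
      rw [hS, Finset.card_image_of_injective _ hv, Finset.card_univ, Fintype.card_fin]
    have hSk : S.card = k := hcard ⟨S, hSP⟩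
    obtain ⟨σ, hσ⟩ : ∃ σ : Equiv.Perm (Fin k), ∀ i, S.orderEmbOfFin hSk (σ i) = v i := by
      have hmem : ∀ i, v i ∈ S := fun i => Finset.mem_image_of_mem v (Finset.mem_univ i)
      have hg : Function.Injective fun i => (S.orderIsoOfFin hSk).symm ⟨v i, hmem i⟩ := by
        intro i j hij
        have h := congrArg (fun t : Fin k => ((S.orderIsoOfFin hSk t : S) : Fin n)) hij
        simp only [OrderIso.apply_symm_apply] at h
        exact hv h
      refine ⟨Equiv.ofBijective _ (Finite.injective_iff_bijective.1 hg), fun i => ?_⟩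
      rw [Equiv.ofBijective_apply, ← Finset.coe_orderIsoOfFin_apply, OrderIso.apply_symm_apply]
    have hvσ : (fun i => Pi.basisFun F (Fin n) (v i))
        = (fun j => Pi.basisFun F (Fin n) (S.orderEmbOfFin hSk j)) ∘ σ := by
      funext i
      simp only [Function.comp_apply, hσ]
    have hfS : f (fun j => Pi.basisFun F (Fin n) (S.orderEmbOfFin hSk j)) = 0 :=
      congrFun hf ⟨S, hSP⟩
    rw [hvσ, AlternatingMap.map_perm, hfS, smul_zero]
  have h := (hx.map' Φ hΦ).fintype_card_le_finrank
  rwa [Fintype.card_fin, Module.finrank_fintype_fun_eq_card F, Fintype.card_coe,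
    Finset.card_powersetCard, Finset.card_univ, Fintype.card_fin] at h

/-- ZONE THEOREM / frame cap (Lovász 1977, skew Bollobás for subspaces; the complementary case
`dim = l + l = 2l`): a ladder of `l`-dimensional pairs `(V c, W c)` in `F^{2l}` that is
complementary on the diagonal (`V c ⊓ W c = ⊥`) and non-spanning below it (`V p ⊔ W q ≠ ⊤` for
`p < q`) has at most `Nat.choose (2 * l) l` classes.  Determinantal proof, see the module
docstring. -/
theorem frameCap {F : Type*} [Field F] {l r : ℕ}
    (V W : Fin r → Submodule F (Fin (2 * l) → F))
    (hdimV : ∀ c, Module.finrank F (V c) = l) (hdimW : ∀ c, Module.finrank F (W c) = l)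
    (hdiag : ∀ c, V c ⊓ W c = ⊥)
    (hcross : ∀ p q : Fin r, p < q → V p ⊔ W q ≠ ⊤) :
    r ≤ (2 * l).choose l := by
  classical
  -- (0) basis families `a c` of `V c` and `b c` of `W c`
  have hbas : ∀ U : Submodule F (Fin (2 * l) → F), Module.finrank F U = l →
      ∃ u : Fin l → (Fin (2 * l) → F), Submodule.span F (Set.range u) = U := fun U hU => by
    let bU := Module.finBasisOfFinrankEq F U hU
    refine ⟨U.subtype ∘ ⇑bU, ?_⟩
    rw [Set.range_comp, Submodule.span_image, bU.span_eq, Submodule.map_top,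
      Submodule.range_subtype]
  choose a ha using fun c => hbas (V c) (hdimV c)
  choose b hb using fun c => hbas (W c) (hdimW c)
  -- (1) the determinant form of `F^{2l}`, its arguments indexed by `Fin l ⊕ Fin l`
  let σ : Fin l ⊕ Fin l ≃ Fin (2 * l) := finSumFinEquiv.trans (finCongr (two_mul l).symm)
  let e : Module.Basis (Fin l ⊕ Fin l) F (Fin (2 * l) → F) :=
    (Pi.basisFun F (Fin (2 * l))).reindex σ.symm
  let D : (Fin (2 * l) → F) [⋀^(Fin l ⊕ Fin l)]→ₗ[F] F := e.det
  have hspan : ∀ p q, Submodule.span F (Set.range (Sum.elim (a p) (b q))) = V p ⊔ W q :=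
    fun p q => by rw [Set.Sum.elim_range, Submodule.span_union, ha, hb]
  have hcardE : Fintype.card (Fin l ⊕ Fin l) = Module.finrank F (Fin (2 * l) → F) := by
    rw [Fintype.card_sum, Fintype.card_fin, Module.finrank_fin_fun F, two_mul]
  -- (2) on the diagonal the determinant is nonzero
  have hdiag' : ∀ c, D (Sum.elim (a c) (b c)) ≠ 0 := fun c => by
    have htop : V c ⊔ W c = ⊤ := by
      apply Submodule.eq_top_of_finrank_eq
      have h := Submodule.finrank_sup_add_finrank_inf_eq (V c) (W c)
      rw [hdiag c, finrank_bot, add_zero, hdimV c, hdimW c] at h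
      rw [h, Module.finrank_fin_fun F, two_mul]
    have hsp : ⊤ ≤ Submodule.span F (Set.range (Sum.elim (a c) (b c))) := by
      rw [hspan, htop]
    have hli : LinearIndependent F (Sum.elim (a c) (b c)) :=
      linearIndependent_of_top_le_span_of_card_eq_finrank hsp hcardE
    exact (e.is_basis_iff_det.1 ⟨hli, top_le_iff.1 hsp⟩).ne_zero
  -- (3) below the diagonal (`p < q`) the determinant vanishes
  have hcross' : ∀ p q, p < q → D (Sum.elim (a p) (b q)) = 0 := fun p q hpq => by
    refine AlternatingMap.map_linearDependent D _ fun hli => hcross p q hpq ?_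
    rw [← hspan]
    exact hli.span_eq_top_of_card_eq_finrank' hcardE
  -- (4) the alternating `l`-forms `x p : w ↦ D (a p ‖ w)`
  let x : Fin r → ((Fin (2 * l) → F) [⋀^Fin l]→ₗ[F] F) := fun p =>
    { D.toMultilinearMap.currySum (a p) with
      map_eq_zero_of_eq' := fun w i j hw hij => by
        change D (Sum.elim (a p) w) = 0
        exact D.map_eq_zero_of_eq (Sum.elim (a p) w) (i := Sum.inr i) (j := Sum.inr j)
          (by simpa using hw) (by simpa using hij) }
  have hx_apply : ∀ p w, x p w = D (Sum.elim (a p) w) := fun p w => rfl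
  -- (5) the `x p` are linearly independent: test against the `b q` (triangular matrix)
  have hx : LinearIndependent F x := by
    rw [Fintype.linearIndependent_iff]
    intro g hg
    let M : Matrix (Fin r) (Fin r) F := Matrix.of fun p q => D (Sum.elim (a p) (b q))
    have hdet : M.det ≠ 0 := by
      rw [Matrix.det_of_lowerTriangular M fun i j hij =>
        hcross' i j (OrderDual.toDual_lt_toDual.1 hij)]
      exact Finset.prod_ne_zero_iff.2 fun c _ => hdiag' c
    -- evaluation at a fixed family `w` is linear in the form
    have heval : ∀ w, (∑ p, g p • x p) w = ∑ p, g p * x p w := fun w => by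
      let ev : ((Fin (2 * l) → F) [⋀^Fin l]→ₗ[F] F) →ₗ[F] F :=
        { toFun := fun f => f w, map_add' := fun _ _ => rfl, map_smul' := fun _ _ => rfl }
      change ev (∑ p, g p • x p) = _
      rw [map_sum]
      rfl
    have hvec : Matrix.vecMul g M = 0 := by
      funext q
      have h0 := congrArg (fun f : (Fin (2 * l) → F) [⋀^Fin l]→ₗ[F] F => f (b q)) hg
      simp only [heval, hx_apply, AlternatingMap.zero_apply] at h0
      simpa [Matrix.vecMul, dotProduct, M] using h0
    exact congrFun (Matrix.eq_zero_of_vecMul_eq_zero hdet hvec)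
  exact altForm_card_le_choose x hx

end Summit.MatrixMultiplication.MatrixMultiplication.Theorems.PrimeTwoFamilies.FrameCapSiegeK5
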